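import Summits.QuantumFields.YangMills.Theorems.FibreConvexityTailDefs
import Summits.QuantumFields.YangMills.Theorems.PoincareLipschitzMeanDeviationOfSecondMoment
import HarnessLib

/-!
# LINE 28 candidate «gross-sd-transfer» — support workfile: the UV-WINDOW second-moment text and its by-name consumers

ERRATUM companion (ideator ym-r3-idea-2 g15, addendum 2 to `MedianCentringQAttackMap.md`).  The Schwinger–Dyson transfer of the LINE 28
candidate reaches only the UV WINDOW `N₁·j ≤ K` (annex 1 §§1–2: every defect is `∝ √γ·L^{(c·j−K)/2}`, `N₁ = 6` radial / `7` axial or with the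
crude (2.123) Poincaré constant), NOT all scales `1 ≤ j ≤ K`.  The text its lever can deliver is therefore the WINDOW statement

  «ShallowFluxSecondMomentL»  ∀ L ∃ N₁ > 0 ∃ C ≥ 0 ∃ γ₁ ∈ (0,1] ∀ F (F.L = L) ∀ 0 < γ ≤ γ₁ ∀ K j (1 ≤ j, N₁·j ≤ K) ∀ a,
                               E_{gibbsK} dist₁(Ū^j(∂a))² ≤ C · γ L^{−(K−j)},

and this def-free, sorry-free file records what follows from it BY NAME, reusing px9 g9's landed ✓p731380
`PoincareLipschitzMeanDeviationOfSecondMoment` lemmas (Chebyshev / AM–GM / the `p(g)²/256` room):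
* `meanDeviationShallowL_of_windowSecondMoment : «ShallowFluxSecondMomentL» → RevelationMartingale.MeanDeviationShallowL` — stmt-QuantumFields-23133,
  LINE 27's REGISTERED TARGET, DIRECTLY (no (Q), no K1, no K2), with the window's own `N₁`;
* `quantileDeviationWindow_of_windowSecondMoment` — the 3/4-quantile (Q) RESTRICTED to the window (informational; the registered (Q) is all-scales `j + 2 ≤ K`);
* `windowSecondMoment_of_blockSecondMoment : «BlockSecondMomentL» → «ShallowFluxSecondMomentL»` — the one-line glue if both texts are minted.
Nothing is claimed about either second-moment text (NOT printed for non-abelian d = 3); (Q), MeanDeviationL (23083), MeanDeviationShallowL (23133),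
HistoryTailL and the rung R3 (YM₃ on T³; NOT d = 4, NOT Clay) remain OPEN.
-/

open MeasureTheory
open Literature.MathematicalPhysics.QuantumFieldTheory.Balaban1983to89
open Literature.MathematicalPhysics.QuantumFieldTheory.Balaban1983to89.T3ContinuumYM3Torus
open Literature.MathematicalPhysics.QuantumFieldTheory.Balaban1983to89.T3UnitScaleTilt
open Literature.MathematicalPhysics.QuantumFieldTheory.Balaban1983to89.T3UnitLawDensityEML (ℰp measurableE_ℰp)
open Literature.MathematicalPhysics.QuantumFieldTheory.Balaban1983to89.T3MinimiserStabilityReduction (θBal_pos)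
open Summit.QuantumFields.YangMills.Theorems.PoincareLipschitzMeanDeviationOfSecondMoment
  (threeQuarters_of_sq_integral integral_le_of_sq_integral const_mul_coupling_le_θBal_sq)

namespace Summit.QuantumFields.YangMills.Cruxes.HistoryTailL.SecondMomentWindow

/-- **Window second moment at threshold scale.**  For every profile `(b₀,p₀)`: `∫ d² ≤ θ²/256` on the window `N₁·j ≤ K`. -/
theorem secondMomentTheta_of_windowSecondMoment
    (hW : ∀ (L : ℕ), ∃ N₁ : ℕ, 0 < N₁ ∧ ∃ C : ℝ, 0 ≤ C ∧ ∃ γ₁ : ℝ, 0 < γ₁ ∧ γ₁ ≤ 1 ∧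
          ∀ (F : T3Family) (γ : ℝ), F.L = L → 0 < γ → γ ≤ γ₁ → ∀ (K j : ℕ), 1 ≤ j → N₁ * j ≤ K → ∀ a : Plaq (F.P K) j,
            ∫ U, (GaugeGroup.dist1 (GaugeField.plaqHol (Averaging.iter (fun i' => BlockAveraging.blockAvg (P := F.P K) (j := i') ℰp) j U) a)) ^ 2 ∂(gibbsK F ℰp γ K)
              ≤ C * (γ * ((F.L : ℝ)⁻¹) ^ (K - j)))
    (L : ℕ) :
    ∃ N₁ : ℕ, 0 < N₁ ∧ ∀ {b₀ p₀ : ℝ}, 0 < b₀ → 2 < p₀ → ∃ γ₁ : ℝ, 0 < γ₁ ∧ γ₁ ≤ 1 ∧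
      ∀ (F : T3Family) (γ : ℝ), F.L = L → 0 < γ → γ ≤ γ₁ → ∀ (K j : ℕ), 1 ≤ j → N₁ * j ≤ K → ∀ a : Plaq (F.P K) j,
        ∫ U, (GaugeGroup.dist1 (GaugeField.plaqHol (Averaging.iter (fun i' => BlockAveraging.blockAvg (P := F.P K) (j := i') ℰp) j U) a)) ^ 2 ∂(gibbsK F ℰp γ K)
          ≤ θBal F.L γ b₀ p₀ (K - j) ^ 2 / 256 := by
  obtain ⟨N₁, hN₁, C, hC, γV, hγV, hγV1, HV⟩ := hW L
  refine ⟨N₁, hN₁, fun {b₀ p₀} hb₀ hp₀ => ?_⟩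
  by_cases hL : 1 ≤ L
  swap
  · refine ⟨1, one_pos, le_rfl, fun F γ hFL => ?_⟩
    exact absurd (hFL ▸ F.hL.2) (by omega)
  obtain ⟨γR, hγR, hγR1, HR⟩ := const_mul_coupling_le_θBal_sq hL hb₀ (by linarith : (1 : ℝ) ≤ p₀) hC
  refine ⟨min γV γR, lt_min hγV hγR, (min_le_left _ _).trans hγV1, ?_⟩
  intro F γ hFL hγ hγle K j hj hjK a
  have h1 := HV F γ hFL hγ (hγle.trans (min_le_left _ _)) K j hj hjK a
  have h2 := HR γ hγ (hγle.trans (min_le_right _ _)) (K - j)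
  rw [hFL] at h1 ⊢
  exact h1.trans h2

/-- **«ShallowFluxSecondMomentL» ⇒ `MeanDeviationShallowL`** (stmt-QuantumFields-23133, LINE 27's registered target) DIRECTLY, with the window's
`N₁`, by AM–GM — no (Q), no K1, no K2. -/
theorem meanDeviationShallowL_of_windowSecondMoment
    (hW : ∀ (L : ℕ), ∃ N₁ : ℕ, 0 < N₁ ∧ ∃ C : ℝ, 0 ≤ C ∧ ∃ γ₁ : ℝ, 0 < γ₁ ∧ γ₁ ≤ 1 ∧
          ∀ (F : T3Family) (γ : ℝ), F.L = L → 0 < γ → γ ≤ γ₁ → ∀ (K j : ℕ), 1 ≤ j → N₁ * j ≤ K → ∀ a : Plaq (F.P K) j,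
            ∫ U, (GaugeGroup.dist1 (GaugeField.plaqHol (Averaging.iter (fun i' => BlockAveraging.blockAvg (P := F.P K) (j := i') ℰp) j U) a)) ^ 2 ∂(gibbsK F ℰp γ K)
              ≤ C * (γ * ((F.L : ℝ)⁻¹) ^ (K - j))) :
    Summit.QuantumFields.YangMills.Theses.RevelationMartingale.MeanDeviationShallowL := by
  intro L
  obtain ⟨N₁, hN₁, H⟩ := secondMomentTheta_of_windowSecondMoment hW L
  refine ⟨N₁, hN₁, fun b₀ p₀ hb₀ hp₀ => ?_⟩
  obtain ⟨γ₁, hγ₁, hγ₁1, Hθ⟩ := H hb₀ hp₀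
  refine ⟨γ₁, hγ₁, hγ₁1, ?_⟩
  intro F γ hFL hγ hγle K j hj hjK a
  have hsq := Hθ F γ hFL hγ hγle K j hj hjK a
  haveI : IsProbabilityMeasure (gibbsK F ℰp γ K) := isProbabilityMeasure_gibbsK F ℰp hγ.le K
  have hL1 : 1 ≤ F.L := le_of_lt F.hL.2
  have hθpos : 0 < θBal F.L γ b₀ p₀ (K - j) := θBal_pos hL1 hγ (hγle.trans hγ₁1) hb₀ p₀ (K - j)
  have hfm := Summit.QuantumFields.YangMills.Theorems.FibreConvexityTail.measurable_dist1_plaqHol_iter F K j a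
  have h := integral_le_of_sq_integral (μ := gibbsK F ℰp γ K) hθpos hfm (fun U => GaugeGroup.dist1_nonneg _)
    (fun U => T4PairDerivBridge.dist1_le_two_specialUnitaryGroup _) hsq
  linarith

/-- **«ShallowFluxSecondMomentL» ⇒ (Q) ON THE WINDOW** (informational: the registered (Q) `stub_quantileDeviation` is all-scales `j + 2 ≤ K`;
the window text gives it only for `N₁·j ≤ K`), by Chebyshev. -/
theorem quantileDeviationWindow_of_windowSecondMoment
    (hW : ∀ (L : ℕ), ∃ N₁ : ℕ, 0 < N₁ ∧ ∃ C : ℝ, 0 ≤ C ∧ ∃ γ₁ : ℝ, 0 < γ₁ ∧ γ₁ ≤ 1 ∧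
          ∀ (F : T3Family) (γ : ℝ), F.L = L → 0 < γ → γ ≤ γ₁ → ∀ (K j : ℕ), 1 ≤ j → N₁ * j ≤ K → ∀ a : Plaq (F.P K) j,
            ∫ U, (GaugeGroup.dist1 (GaugeField.plaqHol (Averaging.iter (fun i' => BlockAveraging.blockAvg (P := F.P K) (j := i') ℰp) j U) a)) ^ 2 ∂(gibbsK F ℰp γ K)
              ≤ C * (γ * ((F.L : ℝ)⁻¹) ^ (K - j))) :
    ∀ (L : ℕ), ∃ N₁ : ℕ, 0 < N₁ ∧ ∀ (b₀ p₀ : ℝ), 0 < b₀ → 2 < p₀ → ∃ γ₁ : ℝ, 0 < γ₁ ∧ γ₁ ≤ 1 ∧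
      ∀ (F : T3Family) (γ : ℝ), F.L = L → 0 < γ → γ ≤ γ₁ → ∀ (K j : ℕ), 1 ≤ j → N₁ * j ≤ K → ∀ a : Plaq (F.P K) j,
        3 / 4 ≤ (gibbsK F ℰp γ K).real {U : GaugeField (F.P K) 0 (Matrix.specialUnitaryGroup (Fin 2) ℂ) |
          GaugeGroup.dist1 (GaugeField.plaqHol (Averaging.iter (fun i' => BlockAveraging.blockAvg (P := F.P K) (j := i') ℰp) j U) a)
            ≤ θBal F.L γ b₀ p₀ (K - j) / 8} := by
  intro L
  obtain ⟨N₁, hN₁, H⟩ := secondMomentTheta_of_windowSecondMoment hW L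
  refine ⟨N₁, hN₁, fun b₀ p₀ hb₀ hp₀ => ?_⟩
  obtain ⟨γ₁, hγ₁, hγ₁1, Hθ⟩ := H hb₀ hp₀
  refine ⟨γ₁, hγ₁, hγ₁1, ?_⟩
  intro F γ hFL hγ hγle K j hj hjK a
  have hsq := Hθ F γ hFL hγ hγle K j hj hjK a
  haveI : IsProbabilityMeasure (gibbsK F ℰp γ K) := isProbabilityMeasure_gibbsK F ℰp hγ.le K
  have hL1 : 1 ≤ F.L := le_of_lt F.hL.2
  have hθpos : 0 < θBal F.L γ b₀ p₀ (K - j) := θBal_pos hL1 hγ (hγle.trans hγ₁1) hb₀ p₀ (K - j)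
  have hfm := Summit.QuantumFields.YangMills.Theorems.FibreConvexityTail.measurable_dist1_plaqHol_iter F K j a
  exact threeQuarters_of_sq_integral (μ := gibbsK F ℰp γ K) hθpos hfm (fun U => GaugeGroup.dist1_nonneg _)
    (fun U => T4PairDerivBridge.dist1_le_two_specialUnitaryGroup _) hsq

/-- **Glue «BlockSecondMomentL» ⇒ «ShallowFluxSecondMomentL»** (instantiation `N₁ = 1`): the all-scales text implies the window text. -/
theorem windowSecondMoment_of_blockSecondMoment
    (hV : ∀ (L : ℕ), ∃ C : ℝ, 0 ≤ C ∧ ∃ γ₁ : ℝ, 0 < γ₁ ∧ γ₁ ≤ 1 ∧ ∀ (F : T3Family) (γ : ℝ), F.L = L → 0 < γ → γ ≤ γ₁ →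
          ∀ (K j : ℕ), 1 ≤ j → j ≤ K → ∀ a : Plaq (F.P K) j,
            ∫ U, (GaugeGroup.dist1 (GaugeField.plaqHol (Averaging.iter (fun i' => BlockAveraging.blockAvg (P := F.P K) (j := i') ℰp) j U) a)) ^ 2 ∂(gibbsK F ℰp γ K)
              ≤ C * (γ * ((F.L : ℝ)⁻¹) ^ (K - j))) :
    ∀ (L : ℕ), ∃ N₁ : ℕ, 0 < N₁ ∧ ∃ C : ℝ, 0 ≤ C ∧ ∃ γ₁ : ℝ, 0 < γ₁ ∧ γ₁ ≤ 1 ∧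
      ∀ (F : T3Family) (γ : ℝ), F.L = L → 0 < γ → γ ≤ γ₁ → ∀ (K j : ℕ), 1 ≤ j → N₁ * j ≤ K → ∀ a : Plaq (F.P K) j,
        ∫ U, (GaugeGroup.dist1 (GaugeField.plaqHol (Averaging.iter (fun i' => BlockAveraging.blockAvg (P := F.P K) (j := i') ℰp) j U) a)) ^ 2 ∂(gibbsK F ℰp γ K)
          ≤ C * (γ * ((F.L : ℝ)⁻¹) ^ (K - j)) := by
  intro L
  obtain ⟨C, hC, γ₁, hγ₁, hγ₁1, H⟩ := hV L
  exact ⟨1, one_pos, C, hC, γ₁, hγ₁, hγ₁1, fun F γ hFL hγ hγle K j hj hjK a => H F γ hFL hγ hγle K j hj (by omega) a⟩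

end Summit.QuantumFields.YangMills.Cruxes.HistoryTailL.SecondMomentWindow
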